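import Literature.Computability.AlgebraicComplexity.BorderRankCWKoszul
import Literature.Computability.AlgebraicComplexity.BorderRankCWKoszulQ4
import Literature.Computability.AlgebraicComplexity.BorderRankCWKoszulRanksSqThree
import Literature.Computability.AlgebraicComplexity.BorderRankCWKoszulRanksSqTwoProofs
import Literature.Computability.AlgebraicComplexity.BorderRankCWKoszulRanksCubeTwoProofs
import Literature.Computability.AlgebraicComplexity.BorderRankCWKoszulPowerQ2Proofs
import Literature.Computability.AlgebraicComplexity.CwSquareGenericRank
import HarnessLib

/-!
# CGLV 2022, Thm. 1.2 (`CGLV2022_thm12`): assembly from the remaining named facts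

Topic `Literature/Computability/AlgebraicComplexity`.  The named fact `CGLV2022_thm12` of
`BorderRankCW.lean` (Conner–Gesmundo–Landsberg–Ventura, *Rank and border rank of Kronecker powers of
tensors and Strassen's laser method*, comput. complexity 31 (2022) = arXiv:1909.04785v2, Thm. 1.2) is
the conjunction `CGLV2022_thm12_square ∧ CGLV2022_thm12_cube ∧ CGLV2022_thm12_power`.  This file
PROVES the implication from what is left unproved in the tree after the 2026-08-15 campaign:

* `CGLV2022_thm33_koszulRank` (`BorderRankCWKoszulRanks.lean`; Thm. 3.3, proof: the `p = 1` Koszul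
  flattening of `φ₂(T_{cw,q}^{⊠2})` has rank `2(q+2)²` for ALL `q ≥ 4` — symbolic in `q`; its `q = 4`
  instance `CGLV2022_thm33_koszulRank_q4` is proved, `BorderRankCWKoszulQ4.lean`) — no longer used
  here: the first paragraph of Thm. 1.2 is proved outright (`CGLV2022_thm12_square_holds`,
  `CwSquareGenericRank.lean`) and this file cites that theorem directly;
* `CGLV2022_thm34_koszulRank` (`BorderRankCWKoszul.lean`; Thm. 3.4, proof: the `p = 2` flattening of
  `φ₃(T_{cw,q}^{⊠3})` has rank `6(q+2)³` for all `q ≥ 5` — the source's `𝔖_{q-4}^{×3}`-isotypic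
  computer calculation of §6);
* `CGLV2022_thm12_power_q2` (`BorderRankCWKoszul.lean`; the printed `q = 2` clause of Thm. 1.2 (iii),
  for which the source prints no proof — see the caveats recorded there and in
  `BorderRankCWKoszulRanks.lean`).

Everything else that Thm. 1.2 needs is proved in the tree and used here: the upper bounds
(`CGLV2022_thm12_upper`), the Koszul border-rank bound (`KoszulFlatteningBorderRank.lean`),
propagation (Prop. 3.2, `KoszulFlatteningKronecker.lean`, `BorderRankCWKoszul.lean`) and the four
kernel-certified flattening ranks (`…_sq_two_holds` (85), `…_sq_three_holds` (150),
`…_cube_two_holds` (265), `CGLV2022_thm33_koszulRank_q4_holds` (72)).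

* `CGLV2022_thm12_cube_of_thm34` — second paragraph from Thm. 3.4's rank alone (`q = 3, 4` by
  propagation from the certified square ranks, `q = 2` by the certified cube rank).
* `CGLV2022_thm12_power_of_thm34` — third paragraph from Thm. 3.4's rank and the `q = 2` clause.
* `CGLV2022_thm12_of` — the whole theorem from Thm. 3.4's rank and the `q = 2` clause (the first
  paragraph is proved outright: `CGLV2022_thm12_square_holds`, `CwSquareGenericRank.lean`);
  `CGLV2022_thm12_of_square` — the same with the first paragraph as a hypothesis.  (The former
  converse projection `CGLV2022_thm12.power_q2 : CGLV2022_thm12 → CGLV2022_thm12_power_q2` was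
  removed on 2026-08-15 as a duplicate: its conclusion is proved outright,
  `CGLV2022_thm12_power_q2_holds`, `BorderRankCWKoszulPowerQ2Proofs.lean`.)

## Restriction-agnostic assembly (added after the square and `q = 2` discharges)

Since then `CGLV2022_thm12_square_holds` (`CwSquareGenericRank.lean`), `CGLV2022_thm12_power_q2_holds`
(`BorderRankCWKoszulPowerQ2Proofs.lean`) and `CGLV2022_thm33_koszulRank_holds` have been proved in the
tree, so the ONLY missing ingredient of Thm. 1.2 is a cube flattening rank for `q ≥ 5`.  The Koszul
bound (eq. (8)) and Prop. 3.2 do not care WHICH restriction `A^{⊗3} → ℂ⁵` is used, so the second half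
of this file proves Thm. 1.2 from the weakest usable form of Thm. 3.4's computation, the hypothesis

  `hK : ∀ q > 4, ∃ φ : ℂ⁵ ← A^{⊗3}, 6(q+2)³ ≤ rank((φ T_{cw,q}^{⊠3})^{∧2}_{ℂ⁵})`

(implied by `CGLV2022_thm34_koszulRank` with `φ = φ₃`, and equally by such a bound for any other
`q`-uniform restriction, e.g. the dead-label extension `extendPhi 5 q (cglvPhi3 ℂ 5)` of
`CwCubeDeadLabels.lean`).  No definitions and no named facts are introduced.

* `cube_le_algBorderRank_of_koszulRank_ge`, `power_le_algBorderRank_of_koszulRank_ge` — the `q ≥ 5`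
  clauses of paragraphs two and three from one restriction `φ` with `6(q+2)³ ≤ rank`.
* `CGLV2022_thm12_cube_of_cubeKoszulRank`, `CGLV2022_thm12_power_of_cubeKoszulRank`,
  `CGLV2022_thm12_of_cubeKoszulRank` — paragraphs two, three and the whole Thm. 1.2 from `hK` alone;
  `CGLV2022_thm12_of_thm34` — the whole Thm. 1.2 from `CGLV2022_thm34_koszulRank` alone.
-/

noncomputable section

namespace Literature.Computability.AlgebraicComplexity

/-- `(q+2)³ ≤ bR(T_{cw,q}^{⊠3})` for `q ≥ 5` from Thm. 3.4's rank (`6((q+2)³ − 1) < 6(q+2)³`).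
[cite: ConnerGesmundoLandsbergVentura2022, Thm. 3.4] -/
theorem cube_le_algBorderRank_of_thm34 (h34 : CGLV2022_thm34_koszulRank) {q : ℕ} (hq : 4 < q) :
    (q + 2) ^ 3 ≤ algBorderRank (kroneckerPow (cwTensor ℂ q) 3) := by
  refine le_algBorderRank_of_lt_rank_koszulFlattening 2 (cglvPhi3 ℂ q) _ ?_
  rw [h34 q (by omega), (by decide : Nat.choose (2 * 2) 2 = 6)]
  have : 1 ≤ (q + 2) ^ 3 := Nat.one_le_pow _ _ (by omega)
  generalize (q + 2) ^ 3 = s at *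
  omega

/-- **Thm. 1.2, second paragraph, from Thm. 3.4's rank**: `bR(T_{cw,q}^{⊠3}) = (q+2)³` for `q > 4`;
`≥ (q+2)²(q+1)` for `q = 3, 4` (Prop. 3.2 from the certified square ranks `150` and `72`); `≥ 15·3`
for `q = 2` (the certified rank `265` of a `p = 2` flattening of the cube).
[cite: ConnerGesmundoLandsbergVentura2022, Thm. 1.2] -/
theorem CGLV2022_thm12_cube_of_thm34 (h34 : CGLV2022_thm34_koszulRank) : CGLV2022_thm12_cube := by
  refine ⟨fun q hq => le_antisymm (algBorderRank_kroneckerPow_cwTensor_le ℂ q 3)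
    (cube_le_algBorderRank_of_thm34 h34 hq), ?_,
    le_algBorderRank_cwTensor_two_cube_of CGLV2022_koszulRank_cube_two_holds⟩
  rintro q (rfl | rfl)
  · simpa using CGLV2022_thm12_power_three_of_koszulRank CGLV2022_koszulRank_sq_three_holds 3 (by norm_num)
  · simpa using CGLV2022_thm12_power_four_of_koszulRank CGLV2022_thm33_koszulRank_q4_holds 3 (by norm_num)

/-- **Thm. 1.2, third paragraph, from Thm. 3.4's rank and the `q = 2` clause** (the `q = 3, 4`
square ranks being certified). [cite: ConnerGesmundoLandsbergVentura2022, Thm. 1.2] -/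
theorem CGLV2022_thm12_power_of_thm34 (h34 : CGLV2022_thm34_koszulRank)
    (h2 : CGLV2022_thm12_power_q2) : CGLV2022_thm12_power :=
  CGLV2022_thm12_power_of_koszulRank h34 CGLV2022_thm33_koszulRank_q4_holds
    CGLV2022_koszulRank_sq_three_holds h2

/-- **CGLV 2022, Thm. 1.2, from Thm. 3.4's rank and the `q = 2` power clause** (the symbolic cube
rank of Thm. 3.4 for all `q ≥ 5`, and the printed `q = 2` clause); the first paragraph is proved
outright (`CGLV2022_thm12_square_holds`, `CwSquareGenericRank.lean`).  For Thm. 1.2 from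
Thm. 3.4's rank ALONE see `CGLV2022_thm12_of_thm34` below.
[cite: ConnerGesmundoLandsbergVentura2022, Thm. 1.2] -/
theorem CGLV2022_thm12_of (h34 : CGLV2022_thm34_koszulRank) (h2 : CGLV2022_thm12_power_q2) :
    CGLV2022_thm12 :=
  ⟨CGLV2022_thm12_square_holds, CGLV2022_thm12_cube_of_thm34 h34,
    CGLV2022_thm12_power_of_thm34 h34 h2⟩

/-- **CGLV 2022, Thm. 1.2, from its first paragraph and the two remaining named facts** — the form
to use once `CGLV2022_thm12_square` is discharged directly (e.g. by a `q`-uniform flattening other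
than `φ₂`, cf. `CwSquareGenericPhi.lean`), bypassing `CGLV2022_thm33_koszulRank`.
[cite: ConnerGesmundoLandsbergVentura2022, Thm. 1.2] -/
theorem CGLV2022_thm12_of_square (hsq : CGLV2022_thm12_square) (h34 : CGLV2022_thm34_koszulRank)
    (h2 : CGLV2022_thm12_power_q2) : CGLV2022_thm12 :=
  ⟨hsq, CGLV2022_thm12_cube_of_thm34 h34, CGLV2022_thm12_power_of_thm34 h34 h2⟩

/-! ## Thm. 1.2 from a rank bound for ANY `p = 2` restriction of the cube (`q ≥ 5`) -/

/-- `(q+2)³ ≤ bR(T_{cw,q}^{⊠3})` from ANY restriction `φ : A^{⊗3} → ℂ⁵` whose `p = 2` Koszul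
flattening has rank `≥ 6(q+2)³` (eq. (8): `6((q+2)³ − 1) < 6(q+2)³ ≤ rank`).
[cite: ConnerGesmundoLandsbergVentura2022, Thm. 3.4 (proof) and eq. (8)] -/
theorem cube_le_algBorderRank_of_koszulRank_ge {q : ℕ}
    (φ : Matrix (Fin (2 * 2 + 1)) (Fin 3 → Fin (q + 1)) ℂ)
    (hφ : 6 * (q + 2) ^ 3 ≤ (koszulFlattening 2 φ.mulVecLin (kroneckerPow (cwTensor ℂ q) 3)).rank) :
    (q + 2) ^ 3 ≤ algBorderRank (kroneckerPow (cwTensor ℂ q) 3) := by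
  refine le_algBorderRank_of_lt_rank_koszulFlattening 2 φ _ (lt_of_lt_of_le ?_ hφ)
  rw [(by decide : Nat.choose (2 * 2) 2 = 6)]
  have : 1 ≤ (q + 2) ^ 3 := Nat.one_le_pow _ _ (by omega)
  generalize (q + 2) ^ 3 = s at *
  omega

/-- `(q+1)^{N-3}(q+2)³ ≤ bR(T_{cw,q}^{⊠N})` (`q ≥ 1`, `N ≥ 3`) from ANY restriction `φ` of the cube
with `6(q+2)³ ≤ rank` (proof of Cor. 3.5: Prop. 3.2 with `T₁ = T_{cw,q}^{⊠3}`,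
`T₂ = T_{cw,q}^{⊠(N-3)}`, which is `1_A`-generic).
[cite: ConnerGesmundoLandsbergVentura2022, Cor. 3.5 (proof)] -/
theorem power_le_algBorderRank_of_koszulRank_ge {q : ℕ} (hq : 1 ≤ q)
    (φ : Matrix (Fin (2 * 2 + 1)) (Fin 3 → Fin (q + 1)) ℂ)
    (hφ : 6 * (q + 2) ^ 3 ≤ (koszulFlattening 2 φ.mulVecLin (kroneckerPow (cwTensor ℂ q) 3)).rank)
    (N : ℕ) (hN : 3 ≤ N) :
    (q + 1) ^ (N - 3) * (q + 2) ^ 3 ≤ algBorderRank (kroneckerPow (cwTensor ℂ q) N) := by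
  have hα := isUnit_contractFirst_cwCovector (K := ℂ) (q := q) hq
  have key := rank_koszulFlattening_mul_pow_le_algBorderRank_kroneckerPow (cwTensor ℂ q) hα 2 3
    (N - 3) N (by omega) φ.mulVecLin
  rw [Fintype.card_fin, show Nat.choose (2 * 2) 2 = 6 by decide] at key
  have key' := (Nat.mul_le_mul_right ((q + 1) ^ (N - 3)) hφ).trans key
  have e : 6 * ((q + 1) ^ (N - 3) * (q + 2) ^ 3) = 6 * (q + 2) ^ 3 * (q + 1) ^ (N - 3) := by ring
  exact Nat.le_of_mul_le_mul_left (e ▸ key') (by norm_num)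

/-- **Thm. 1.2, second paragraph, from a cube flattening rank bound for `q ≥ 5`** (any
restriction; `q = 3, 4` by propagation from the certified square ranks `150`, `72`; `q = 2` by the
certified cube rank `265`).
[cite: ConnerGesmundoLandsbergVentura2022, Thm. 1.2] -/
theorem CGLV2022_thm12_cube_of_cubeKoszulRank
    (hK : ∀ q : ℕ, 4 < q → ∃ φ : Matrix (Fin (2 * 2 + 1)) (Fin 3 → Fin (q + 1)) ℂ,
      6 * (q + 2) ^ 3 ≤ (koszulFlattening 2 φ.mulVecLin (kroneckerPow (cwTensor ℂ q) 3)).rank) :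
    CGLV2022_thm12_cube := by
  refine ⟨fun q hq => le_antisymm (algBorderRank_kroneckerPow_cwTensor_le ℂ q 3) ?_, ?_,
    le_algBorderRank_cwTensor_two_cube_of CGLV2022_koszulRank_cube_two_holds⟩
  · obtain ⟨φ, hφ⟩ := hK q hq
    exact cube_le_algBorderRank_of_koszulRank_ge φ hφ
  rintro q (rfl | rfl)
  · simpa using CGLV2022_thm12_power_three_of_koszulRank CGLV2022_koszulRank_sq_three_holds 3 (by norm_num)
  · simpa using CGLV2022_thm12_power_four_of_koszulRank CGLV2022_thm33_koszulRank_q4_holds 3 (by norm_num)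

/-- **Thm. 1.2, third paragraph, from a cube flattening rank bound for `q ≥ 5`** (any
restriction; the `q = 3, 4` square ranks being certified and the `q = 2` clause proved,
`CGLV2022_thm12_power_q2_holds`).
[cite: ConnerGesmundoLandsbergVentura2022, Thm. 1.2] -/
theorem CGLV2022_thm12_power_of_cubeKoszulRank
    (hK : ∀ q : ℕ, 4 < q → ∃ φ : Matrix (Fin (2 * 2 + 1)) (Fin 3 → Fin (q + 1)) ℂ,
      6 * (q + 2) ^ 3 ≤ (koszulFlattening 2 φ.mulVecLin (kroneckerPow (cwTensor ℂ q) 3)).rank) :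
    CGLV2022_thm12_power := by
  refine ⟨fun q N hq hN => ?_, ?_, CGLV2022_thm12_power_q2_holds⟩
  · obtain ⟨φ, hφ⟩ := hK q hq
    exact power_le_algBorderRank_of_koszulRank_ge (by omega) φ hφ N hN
  rintro q N (rfl | rfl) hN
  · simpa using CGLV2022_thm12_power_three_of_koszulRank CGLV2022_koszulRank_sq_three_holds N hN
  · simpa using CGLV2022_thm12_power_four_of_koszulRank CGLV2022_thm33_koszulRank_q4_holds N hN

/-- **CGLV 2022, Thm. 1.2, from a cube flattening rank bound for `q ≥ 5` alone**: for every `q > 4`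
SOME restriction `φ : A^{⊗3} → ℂ⁵` with `6(q+2)³ ≤ rank((φ T_{cw,q}^{⊠3})^{∧2}_{ℂ⁵})` (the first
paragraph being proved, `CGLV2022_thm12_square_holds`, and so is the `q = 2` clause,
`CGLV2022_thm12_power_q2_holds`). [cite: ConnerGesmundoLandsbergVentura2022, Thm. 1.2] -/
theorem CGLV2022_thm12_of_cubeKoszulRank
    (hK : ∀ q : ℕ, 4 < q → ∃ φ : Matrix (Fin (2 * 2 + 1)) (Fin 3 → Fin (q + 1)) ℂ,
      6 * (q + 2) ^ 3 ≤ (koszulFlattening 2 φ.mulVecLin (kroneckerPow (cwTensor ℂ q) 3)).rank) :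
    CGLV2022_thm12 :=
  ⟨CGLV2022_thm12_square_holds, CGLV2022_thm12_cube_of_cubeKoszulRank hK,
    CGLV2022_thm12_power_of_cubeKoszulRank hK⟩

/-- **CGLV 2022, Thm. 1.2, from Thm. 3.4's rank statement alone.**
[cite: ConnerGesmundoLandsbergVentura2022, Thm. 1.2] -/
theorem CGLV2022_thm12_of_thm34 (h34 : CGLV2022_thm34_koszulRank) : CGLV2022_thm12 :=
  CGLV2022_thm12_of_cubeKoszulRank fun q hq => ⟨cglvPhi3 ℂ q, (h34 q (by omega)).ge⟩

end Literature.Computability.AlgebraicComplexity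

end
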